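import Mathlib.AlgebraicGeometry.Morphisms.Separated
import Mathlib.AlgebraicGeometry.Morphisms.FiniteType
import Mathlib.AlgebraicGeometry.Noetherian
import Mathlib.AlgebraicGeometry.Limits
import HarnessLib

/-!
# A coproduct of separated `S`-schemes is separated over `S` (and locally of finite type, locally Noetherian)

Layer `Literature/AlgebraicGeometry/Morphisms`, namespace `Literature.AlgebraicGeometry.Morphisms`.  Mathlib only.  Theorems only: no
definition, no named fact, no instance, no notation, no `sorry`.

For a family `f i : X i ⟶ S` of morphisms of schemes and the induced morphism `Sigma.desc f : ∐ X ⟶ S` (Mathlib's coproduct of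
schemes, `AlgebraicGeometry/Limits.lean`):

* **`isSeparated_sigmaDesc`** — if every `f i` is separated then so is `Sigma.desc f`.  Separatedness is NOT Zariski-local at the
  source, so this is not Mathlib's `IsZariskiLocalAtSource.sigmaDesc`; the proof reads the diagonal of `∐ X → S` on the open cover of
  `(∐ X) ×_S (∐ X)` by the `X a ×_S X b` (Mathlib `Scheme.Pullback.openCoverOfLeftRight` of two copies of `sigmaOpenCover`): by Mathlib
  `pullback_map_diagonal_isPullback` its restriction to `X a ×_S X b` is `X a ×_{∐ X} X b ⟶ X a ×_S X b`, whose source is EMPTY for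
  `a ≠ b` (Mathlib `isEmpty_pullback_sigmaι_of_ne`) and which for `a = b` is the diagonal of `f a` up to the isomorphism
  `X a ×_{∐ X} X a ≅ X a` (`Sigma.ι` is a monomorphism) (Stacks 01KH ∕ Görtz–Wedhorn I Prop. 9.13: separatedness may be checked on an
  open cover of the target of the diagonal).
* `locallyOfFiniteType_sigmaDesc` — Zariski-local at the source (Mathlib `IsZariskiLocalAtSource.sigmaDesc`).
* `isLocallyNoetherian_sigma` — `∐ X` is locally Noetherian if every `X i` is (Mathlib `isLocallyNoetherian_iff_openCover` on
  `sigmaOpenCover`).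

Cell hodgecm-mathlib, F-4 (II-b) Hom-scheme assembly (b4), junction J-IIb-4 of B-p20 (g14)'s census v2 678aecb9 §3 («`M := ∐_P M_P → S` is
separated, locally of finite type, locally Noetherian»), B-p14 (g20).  Count-neutral capital, upstreamable to Mathlib as is: HC_CM is proved only
modulo the 7 printed citations until rung 0 closes; nothing here bears on it.

## References

* The Stacks Project, Tag 01KH (Lemma 26.21.7: separatedness and coverings) and Tag 01JB (disjoint unions of schemes). [StacksProject]
* U. Görtz, T. Wedhorn, *Algebraic Geometry I* (2nd ed., 2020), Def. 9.7 (p. 233) and Prop. 9.13 (p. 234). [GortzWedhorn2020]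
-/

noncomputable section

set_option backward.isDefEq.respectTransparency false

open CategoryTheory CategoryTheory.Limits AlgebraicGeometry

universe v u

namespace Literature.AlgebraicGeometry.Morphisms

variable {S : Scheme.{u}} {σ : Type u} {X : σ → Scheme.{u}} (f : ∀ i, X i ⟶ S)

/-- The restriction of the diagonal of `∐ X → S` to the chart `X a ×_S X b`, namely
`X a ×_{∐ X} X b ⟶ X a ×_S X b`, is a closed immersion when `f a` is separated: for `a ≠ b` its source is empty, for `a = b` it is
`pr₁ ≫ Δ_{f a}` with `pr₁ : X a ×_{∐ X} X a ⟶ X a` an isomorphism. [cite: StacksProject, Tag 01KH] -/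
theorem isClosedImmersion_pullback_map_sigmaι [∀ i, IsSeparated (f i)] (a b : σ) :
    IsClosedImmersion (pullback.map (Sigma.ι X a) (Sigma.ι X b) (Sigma.ι X a ≫ Sigma.desc f) (Sigma.ι X b ≫ Sigma.desc f)
      (𝟙 _) (𝟙 _) (Sigma.desc f) (Category.id_comp _).symm (Category.id_comp _).symm) := by
  by_cases hab : a = b
  · subst hab
    -- `X a ×_{∐ X} X a`: both projections agree (`Sigma.ι` is mono) and the map is `pr₁ ≫ Δ_{ι ≫ desc}`
    have hΔ : pullback.map (Sigma.ι X a) (Sigma.ι X a) (Sigma.ι X a ≫ Sigma.desc f) (Sigma.ι X a ≫ Sigma.desc f)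
        (𝟙 _) (𝟙 _) (Sigma.desc f) (Category.id_comp _).symm (Category.id_comp _).symm =
        pullback.fst (Sigma.ι X a) (Sigma.ι X a) ≫ pullback.diagonal (Sigma.ι X a ≫ Sigma.desc f) := by
      apply pullback.hom_ext
      · simp
      · simp [fst_eq_snd_of_mono_eq]
    haveI : IsSeparated (Sigma.ι X a ≫ Sigma.desc f) := by rw [Sigma.ι_desc]; infer_instance
    haveI : IsClosedImmersion (pullback.diagonal (Sigma.ι X a ≫ Sigma.desc f)) := IsSeparated.isClosedImmersion_diagonal
    rw [hΔ]
    infer_instance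
  · haveI : IsEmpty ↑(pullback (Sigma.ι X a) (Sigma.ι X b)) := isEmpty_pullback_sigmaι_of_ne X hab
    infer_instance

/-- **A coproduct of separated `S`-schemes is separated over `S`**: if every `f i : X i ⟶ S` is separated, so is
`Sigma.desc f : ∐ X ⟶ S`.  The diagonal is a closed immersion locally on the cover of `(∐ X) ×_S (∐ X)` by the `X a ×_S X b`, where it
restricts to the closed immersion `isClosedImmersion_pullback_map_sigmaι` (Mathlib `pullback_map_diagonal_isPullback`).
[cite: StacksProject, Tag 01KH] [cite: GortzWedhorn2020, Def. 9.7 (p. 233) and Prop. 9.13 (p. 234)] -/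
theorem isSeparated_sigmaDesc [∀ i, IsSeparated (f i)] : IsSeparated (Sigma.desc f) := by
  constructor
  let 𝒰 := Scheme.Pullback.openCoverOfLeftRight (sigmaOpenCover X) (sigmaOpenCover X) (Sigma.desc f) (Sigma.desc f)
  apply IsZariskiLocalAtTarget.of_openCover (P := @IsClosedImmersion) 𝒰
  intro ab
  obtain ⟨a, b⟩ := ab
  -- the chart `X a ×_S X b ⟶ (∐ X) ×_S (∐ X)` and the restricted diagonal on it
  change IsClosedImmersion (pullback.snd (pullback.diagonal (Sigma.desc f))
    (pullback.map (Sigma.ι X a ≫ Sigma.desc f) (Sigma.ι X b ≫ Sigma.desc f) (Sigma.desc f) (Sigma.desc f)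
      (Sigma.ι X a) (Sigma.ι X b) (𝟙 S) (Category.comp_id _) (Category.comp_id _)))
  have hsq := pullback_map_diagonal_isPullback (Sigma.ι X a) (Sigma.ι X b) (Sigma.desc f)
  have hsnd : pullback.snd (pullback.diagonal (Sigma.desc f))
      (pullback.map (Sigma.ι X a ≫ Sigma.desc f) (Sigma.ι X b ≫ Sigma.desc f) (Sigma.desc f) (Sigma.desc f)
        (Sigma.ι X a) (Sigma.ι X b) (𝟙 S) (Category.comp_id _) (Category.comp_id _)) =
      hsq.isoPullback.inv ≫ pullback.map (Sigma.ι X a) (Sigma.ι X b) (Sigma.ι X a ≫ Sigma.desc f)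
        (Sigma.ι X b ≫ Sigma.desc f) (𝟙 _) (𝟙 _) (Sigma.desc f) (Category.id_comp _).symm (Category.id_comp _).symm := by
    rw [Iso.eq_inv_comp, hsq.isoPullback_hom_snd]
  rw [hsnd]
  haveI := isClosedImmersion_pullback_map_sigmaι f a b
  infer_instance

/-- A coproduct of `S`-schemes locally of finite type is locally of finite type over `S` (Zariski-local at the source, Mathlib
`IsZariskiLocalAtSource.sigmaDesc`). [cite: StacksProject, Tag 01JB] -/
theorem locallyOfFiniteType_sigmaDesc [h : ∀ i, LocallyOfFiniteType (f i)] : LocallyOfFiniteType (Sigma.desc f) :=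
  IsZariskiLocalAtSource.sigmaDesc h

/-- A coproduct of locally Noetherian schemes is locally Noetherian (the summands form an open cover, Mathlib `sigmaOpenCover`).
[cite: StacksProject, Tag 01JB] -/
theorem isLocallyNoetherian_sigma (Y : σ → Scheme.{u}) [∀ i, IsLocallyNoetherian (Y i)] : IsLocallyNoetherian (∐ Y) :=
  (isLocallyNoetherian_iff_openCover (sigmaOpenCover Y)).mpr fun i => by
    change IsLocallyNoetherian (Y i); infer_instance

end Literature.AlgebraicGeometry.Morphisms

end
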